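import Summits.AtomisticToContinuum.Crystallization.Theorems.FrustratedLawDichotomyPeriodicBlockFlags
import Summits.AtomisticToContinuum.Crystallization.Theorems.FrustratedLawDichotomyExemptSplit

/-!
# FrustratedLawDichotomy · crux `AperiodicFrustratedLawGap` (stmt-AtomisticToContinuum-27623) — PERIODIC-BLOCK NEGATIVE KERNEL, part E:
# the X-EXTENSION (pair-level laws WITH AN EXEMPTION INDICATOR, e.g. `Eopt♭ / Topt♭ = SchurElasticPricingX / SchurTopologicalPricingX`)
# (decomp-a2c, prover hand 2, structural share, generation 16; hand-2 g15 memo §2 «typable extension»; critic rows 567 (C) / 573 (C)(3))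

The E-side and T-side doors of record price exemptions: `c₀·N + c₁·#good(η₀) + c₂·#good(η₁) + c₃·#{i : Ex y i} ≤ U_W − A·N` with `c₃ = −D_X ≤ 0`
(`…ExemptSplit.SchurElasticPricingX`, `…SchurTopologicalPricingX`; `Ex = LocOptFails e⋆ ε ϱ K` in `…OptimalityCut.EoptFourHalf`).  A periodic witness
refutes such a law only if its interior block sites are CERTIFIED NON-EXEMPT (boundary exemptions are `O(n²)` and absorbed); exemption predicates are in
general NOT local (the `LocOpt` fields are whole-cluster sums), so the certificate is asked AT THE BLOCK SITES, uniformly in the block size `n` and the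
re-indexing `e` — hypothesis `hflX` below (to be discharged, for `LocOptFails`, by a local-optimality-with-margin certificate on the supercell motif
plus a tail estimate: a separate piece, NOT in this file).

* `exCount_reindex` — `#{i : Ex (Y ∘ e.symm) i}` as a sum of indicators over the block index type;
* ★★ `not_pairLevelLawX_of_cell_flags` — cell data as in parts B–D, certified goodness flags `i₀, i₁` per class (part D), certified exemption flags `iX`
  per class at all interior block sites, deficit below the class levels `c₀ + c₁ i₀ + c₂ i₁ + c₃ iX` ⟹ the X-law fails (stated inline, no new def);
* `not_schurElasticPricingX_of_cell_flags` (`c = (eUp − D_E, −(κ_E + C_E), κ_E + D_E, −D_X)`), `not_schurTopologicalPricingX_of_cell_flags`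
  (`c = (eUp + κ_T, −C_T, −κ_T, −D_T)`); ★ `not_schurElasticPricingX_of_cell_strained_nonExempt` (all classes `η₁`-good, `η₀`-bad, non-exempt:
  ¬Eopt♭-shape for EVERY `C_E, D_E, D_X` from a deficit below `eUp + κ_E`) and `not_schurTopologicalPricingX_of_cell_allBad_nonExempt`
  (¬Topt♭-shape for every `C_T, D_T` from a deficit below `eUp + κ_T`).
All `[folklore]`; 0 sorry; no definitions.
-/

noncomputable section

namespace Summit.AtomisticToContinuum.Crystallization.Theorems.FrustratedLawDichotomyPeriodicBlockFlagsX

open scoped BigOperators Classical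
open Metric
open Literature.MathematicalPhysics.StatisticalMechanics (interactionEnergy lennardJones)
open Summit.AtomisticToContinuum.Crystallization.Theorems.ChargedEnergyGapNegative (E3)
open Summit.AtomisticToContinuum.Crystallization.Theorems.FrustratedLawDichotomyRangeCut
open Summit.AtomisticToContinuum.Crystallization.Theorems.FrustratedLawDichotomyMotifLemmas (GoodAtScale)
open Summit.AtomisticToContinuum.Crystallization.Theorems.FrustratedLawDichotomyMotifDoorE (MaybeGoodAt)
open Summit.AtomisticToContinuum.Crystallization.Theorems.FrustratedLawDichotomySchurCut
open Summit.AtomisticToContinuum.Crystallization.Theorems.FrustratedLawDichotomyExemptDoor (SitePred)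
open Summit.AtomisticToContinuum.Crystallization.Theorems.FrustratedLawDichotomyExemptSplit (SchurTopologicalPricingX SchurElasticPricingX)
open Summit.AtomisticToContinuum.Crystallization.Theorems.FrustratedLawDichotomyPeriodicBlockGeometry
open Summit.AtomisticToContinuum.Crystallization.Theorems.FrustratedLawDichotomyPeriodicBlockKernel
open Summit.AtomisticToContinuum.Crystallization.Theorems.FrustratedLawDichotomyPeriodicBlockViolation
open Summit.AtomisticToContinuum.Crystallization.Theorems.FrustratedLawDichotomyPeriodicBlockFlags

/-! ## §1. Counting exempt sites on a re-indexed block -/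

/-- **The exempt count, re-indexed**: `#{i : Ex (Y ∘ e.symm) i} = Σ_p 𝟙[Ex (Y ∘ e.symm) (e p)]`. [folklore] -/
theorem exCount_reindex {ι : Type*} [Fintype ι] {N : ℕ} (e : ι ≃ Fin N) (Y : ι → E3) (Ex : SitePred) :
    (Nat.card {i : Fin N // Ex N (Y ∘ e.symm) i} : ℝ) = ∑ p : ι, (if Ex N (Y ∘ e.symm) (e p) then (1 : ℝ) else 0) := by
  rw [Nat.card_eq_fintype_card, Fintype.card_subtype, ← Finset.sum_boole]
  exact (e.sum_comp (fun i => if Ex N (Y ∘ e.symm) i then (1 : ℝ) else 0)).symm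

/-! ## §2. The X-kernel -/

/-- ★★ **THE PERIODIC-BLOCK NEGATIVE KERNEL WITH AN EXEMPTION INDICATOR.**  Cell data as in parts B–D; certified goodness flags `i₀ m, i₁ m ∈ {0,1}`
per class (as in `not_pairLevelLaw_of_cell_flags`); certified EXEMPTION flags `iX m ∈ {0,1}` per class, valid at every interior site of every block
(`hflX`); and the deficit `Σ_m r m ≤ Σ_m (c₀ + c₁ i₀ m + c₂ i₁ m + c₃ iX m) − N₀ δ`, `δ > 0`.  Then the pair-level law with exemption indicator
`c₀·N + c₁·#good(η₀) + c₂·#good(η₁) + c₃·#{i : Ex y i} ≤ U_W − A·N` FAILS (on the `n`-blocks with `n > 48 k₀ β⁺/δ`). [folklore] -/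
theorem not_pairLevelLawX_of_cell_flags {N₀ M k₀ : ℕ} {x : Fin N₀ → E3} {a b : Fin 3 → E3} {cB ϱ diam : ℝ} (hN₀ : 1 ≤ N₀)
    (hsep : PerSep x a) (hdual : ∀ j k, inner ℝ (b j) (a k) = if j = k then (1 : ℝ) else 0) (hb : ∀ j, ‖b j‖ ≤ cB)
    (hdiam : DiamLE x diam) (hk₀ : cB * (ϱ + diam) < k₀ + 1)
    {μ : Fin M → Fin N₀} {σ : Fin M → Fin 3 → ℤ} (hμσ : Function.Injective fun q => (μ q, σ q)) (hσ : ∀ q k, |σ q k| ≤ k₀)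
    (hsup : ∀ (m : Fin N₀) (s : Fin 3 → ℤ), (∀ k, |s k| ≤ k₀) → ∃ q, μ q = m ∧ σ q = s)
    {cidx : Fin N₀ → Fin M} (hc : ∀ m, μ (cidx m) = m ∧ σ (cidx m) = 0)
    {W : ℝ → ℝ} {R Wsup : ℝ} (hR0 : 0 ≤ R) (hW : ∀ r, R ≤ r → W r = 0) (hRϱ : R ≤ ϱ)
    (hWle : ∀ r, (7 : ℝ) / 10 ≤ r → W r ≤ Wsup) (hWsup : 0 ≤ Wsup)
    {η₀ η₁ D : ℝ} (hD : 13 / 10 * D + 1 ≤ ϱ) (hη₀ : η₀ ≤ 3 / 10) (hη₁ : η₁ ≤ 3 / 10) {i₀ i₁ : Fin N₀ → ℝ}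
    (hfl₀ : ∀ m, (i₀ m = 1 ∧ GoodAtScale η₀ D (superMotif x a μ σ) (cidx m)) ∨ (i₀ m = 0 ∧ ¬ MaybeGoodAt η₀ D (superMotif x a μ σ) (cidx m)))
    (hfl₁ : ∀ m, (i₁ m = 1 ∧ GoodAtScale η₁ D (superMotif x a μ σ) (cidx m)) ∨ (i₁ m = 0 ∧ ¬ MaybeGoodAt η₁ D (superMotif x a μ σ) (cidx m)))
    (Ex : SitePred) {iX : Fin N₀ → ℝ}
    (hflX : ∀ (n N : ℕ) (e : (Fin N₀ × (Fin 3 → Fin n)) ≃ Fin N) (m : Fin N₀) (t : Fin 3 → Fin n), Interior k₀ n t →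
      (iX m = 1 ∧ Ex N (block x a n ∘ e.symm) (e (m, t))) ∨ (iX m = 0 ∧ ¬ Ex N (block x a n ∘ e.symm) (e (m, t))))
    {A δ : ℝ} (hδ : 0 < δ) {c₀ c₁ c₂ c₃ : ℝ}
    (hdef : ∑ m, (((∑ q, W (dist (x m) (superMotif x a μ σ q))) - W 0) / 2 - A) ≤
      (∑ m, (c₀ + c₁ * i₀ m + c₂ * i₁ m + c₃ * iX m)) - N₀ * δ) :
    ¬ (∀ (N : ℕ) (y : Fin N → E3), Function.Injective y → Sep y →
        c₀ * N + c₁ * goodCount η₀ y + c₂ * goodCount η₁ y + c₃ * (Nat.card {i : Fin N // Ex N y i} : ℝ) ≤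
          interactionEnergy W y - A * N) := by
  intro hlaw
  -- boundary relief per site and the block size
  set β : ℝ := max (((20 * R / 7 + 1) ^ 3 * Wsup) / 2 - A - c₀ - min c₁ 0 - min c₂ 0 - min c₃ 0) 0 with hβ
  have hβ0 : 0 ≤ β := le_max_right _ _
  have hβle : ((20 * R / 7 + 1) ^ 3 * Wsup) / 2 - A - c₀ - min c₁ 0 - min c₂ 0 - min c₃ 0 ≤ β := le_max_left _ _
  obtain ⟨n, hn4, hn1, hbig⟩ : ∃ n : ℕ, 4 * k₀ ≤ n ∧ 1 ≤ n ∧ 48 * (k₀ : ℝ) * β < δ * n := by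
    obtain ⟨n₁, hn₁⟩ := exists_nat_gt (48 * (k₀ : ℝ) * β / δ)
    refine ⟨max (4 * k₀ + 1) n₁, by omega, by omega, ?_⟩
    have h1 : (n₁ : ℝ) ≤ ((max (4 * k₀ + 1) n₁ : ℕ) : ℝ) := by exact_mod_cast le_max_right _ _
    rw [div_lt_iff₀ hδ] at hn₁
    nlinarith
  -- re-index the `n`-block by `Fin N`
  suffices key : ∀ (N : ℕ) (e : (Fin N₀ × (Fin 3 → Fin n)) ≃ Fin N), False from key _ (Fintype.equivFin _)
  intro N e
  have hNcard : Fintype.card (Fin N₀ × (Fin 3 → Fin n)) = N := card_reindex e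
  have hNval : (N : ℝ) = N₀ * (n : ℝ) ^ 3 := by
    rw [← hNcard, Fintype.card_prod, Fintype.card_fin, Fintype.card_fun, Fintype.card_fin, Fintype.card_fin]
    push_cast
    ring
  have hYsep := block_sep hsep n
  have hYinj := block_injective hsep n
  have hmain := hlaw N (block x a n ∘ e.symm) (injective_reindex e hYinj) (sep_reindex e hYsep)
  have h2U := interactionEnergy_reindex e (block x a n) W
  have hg₀ := goodCount_reindex e (block x a n) η₀
  have hg₁ := goodCount_reindex e (block x a n) η₁
  have hgX := exCount_reindex e (block x a n) Ex
  -- abbreviations: the flags, the site sums, the class deficits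
  set ind₀ : Fin N₀ × (Fin 3 → Fin n) → ℝ := fun p => if GoodAt η₀ (block x a n ∘ e.symm) (e p) then (1 : ℝ) else 0 with hind₀
  set ind₁ : Fin N₀ × (Fin 3 → Fin n) → ℝ := fun p => if GoodAt η₁ (block x a n ∘ e.symm) (e p) then (1 : ℝ) else 0 with hind₁
  set indX : Fin N₀ × (Fin 3 → Fin n) → ℝ := fun p => if Ex N (block x a n ∘ e.symm) (e p) then (1 : ℝ) else 0 with hindX
  set S : Fin N₀ × (Fin 3 → Fin n) → ℝ := fun p => ∑ q, W (dist (block x a n p) (block x a n q)) with hSdef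
  set r : Fin N₀ → ℝ := fun m => ((∑ q, W (dist (x m) (superMotif x a μ σ q))) - W 0) / 2 - A with hr
  set lev : Fin N₀ → ℝ := fun m => c₀ + c₁ * i₀ m + c₂ * i₁ m + c₃ * iX m with hlev
  -- the doubled per-site excess has non-negative total (this is the law on the block)
  set X : Fin N₀ × (Fin 3 → Fin n) → ℝ := fun p =>
    S p - W 0 - 2 * A - 2 * c₀ - 2 * c₁ * ind₀ p - 2 * c₂ * ind₁ p - 2 * c₃ * indX p with hX
  have hXsum : ∑ p, X p = (∑ p, S p) - N * W 0 - N * (2 * A) - N * (2 * c₀) - 2 * c₁ * (∑ p, ind₀ p) - 2 * c₂ * (∑ p, ind₁ p)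
      - 2 * c₃ * (∑ p, indX p) := by
    simp only [hX, Finset.sum_sub_distrib, Finset.sum_const, Finset.card_univ, hNcard, nsmul_eq_mul, ← Finset.mul_sum]
  have hsumX : 0 ≤ ∑ p, X p := by
    rw [hXsum]
    rw [hg₀, hg₁, hgX] at hmain
    linarith only [hmain, h2U]
  -- interior sites: exact site sum, flags `(bad, good)`
  have hint : ∀ p : Fin N₀ × (Fin 3 → Fin n), Interior k₀ n p.2 → X p = 2 * (r p.1 - lev p.1) := by
    rintro ⟨m, t⟩ ht
    have hS : S (m, t) = ∑ q, W (dist (x m) (superMotif x a μ σ q)) := by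
      simp only [hSdef]
      exact siteSum_block_eq (n := n) hsep hdual hb hdiam hk₀ hμσ hσ hsup hW hRϱ ht m
    have h0 : ind₀ (m, t) = i₀ m := by
      rcases hfl₀ m with ⟨hi, hG⟩ | ⟨hi, hB⟩
      · rw [hi]; simp only [hind₀]
        exact if_pos (goodAt_block_of_superMotif hdual hb hdiam hk₀ hσ hsup hc hD e ht hG)
      · rw [hi]; simp only [hind₀]
        exact if_neg (not_goodAt_block_of_superMotif hsep hdual hb hdiam hk₀ hμσ hσ hsup hc hD hη₀ e ht hB)
    have h1 : ind₁ (m, t) = i₁ m := by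
      rcases hfl₁ m with ⟨hi, hG⟩ | ⟨hi, hB⟩
      · rw [hi]; simp only [hind₁]
        exact if_pos (goodAt_block_of_superMotif hdual hb hdiam hk₀ hσ hsup hc hD e ht hG)
      · rw [hi]; simp only [hind₁]
        exact if_neg (not_goodAt_block_of_superMotif hsep hdual hb hdiam hk₀ hμσ hσ hsup hc hD hη₁ e ht hB)
    have h3 : indX (m, t) = iX m := by
      rcases hflX n N e m t ht with ⟨hi, hE⟩ | ⟨hi, hE⟩
      · rw [hi]; simp only [hindX]; exact if_pos hE
      · rw [hi]; simp only [hindX]; exact if_neg hE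
    simp only [hX, hr, hlev, h0, h1, h3, hS]
    ring
  -- boundary sites: `X p ≤ 2β`
  have hbdry : ∀ p : Fin N₀ × (Fin 3 → Fin n), X p ≤ 2 * β := by
    intro p
    have hS : S p ≤ W 0 + (20 * R / 7 + 1) ^ 3 * Wsup := by
      simp only [hSdef]
      exact siteSum_le_of_sep hYinj hYsep hR0 hW hWle hWsup p
    have h₀ : min c₁ 0 ≤ c₁ * ind₀ p := by
      by_cases hq : GoodAt η₀ (block x a n ∘ e.symm) (e p)
      · have : ind₀ p = 1 := by simp only [hind₀]; exact if_pos hq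
        rw [this, mul_one]; exact min_le_left _ _
      · have : ind₀ p = 0 := by simp only [hind₀]; exact if_neg hq
        rw [this, mul_zero]; exact min_le_right _ _
    have h₁ : min c₂ 0 ≤ c₂ * ind₁ p := by
      by_cases hq : GoodAt η₁ (block x a n ∘ e.symm) (e p)
      · have : ind₁ p = 1 := by simp only [hind₁]; exact if_pos hq
        rw [this, mul_one]; exact min_le_left _ _
      · have : ind₁ p = 0 := by simp only [hind₁]; exact if_neg hq
        rw [this, mul_zero]; exact min_le_right _ _
    have h₃ : min c₃ 0 ≤ c₃ * indX p := by
      by_cases hq : Ex N (block x a n ∘ e.symm) (e p)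
      · have : indX p = 1 := by simp only [hindX]; exact if_pos hq
        rw [this, mul_one]; exact min_le_left _ _
      · have : indX p = 0 := by simp only [hindX]; exact if_neg hq
        rw [this, mul_zero]; exact min_le_right _ _
    have hXp : X p = S p - W 0 - 2 * A - 2 * c₀ - 2 * c₁ * ind₀ p - 2 * c₂ * ind₁ p - 2 * c₃ * indX p := rfl
    rw [hXp]
    linarith only [hS, h₀, h₁, h₃, hβle]
  -- split the total into interior and boundary
  have hsplit := (Finset.sum_filter_add_sum_filter_not (Finset.univ : Finset (Fin N₀ × (Fin 3 → Fin n)))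
    (fun p => Interior k₀ n p.2) X).symm
  have hI : ∑ p ∈ Finset.univ.filter (fun p : Fin N₀ × (Fin 3 → Fin n) => Interior k₀ n p.2), X p =
      (interiorSet k₀ n).card * ∑ m, 2 * (r m - lev m) := by
    rw [← sum_interior_class]
    exact Finset.sum_congr rfl fun p hp => hint p (Finset.mem_filter.1 hp).2
  have hB : ∑ p ∈ Finset.univ.filter (fun p : Fin N₀ × (Fin 3 → Fin n) => ¬ Interior k₀ n p.2), X p ≤
      N₀ * ((n : ℝ) ^ 3 - (interiorSet k₀ n).card) * (2 * β) := by
    rw [← card_boundary N₀ k₀ n]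
    have := Finset.sum_le_card_nsmul (Finset.univ.filter (fun p : Fin N₀ × (Fin 3 → Fin n) => ¬ Interior k₀ n p.2)) X (2 * β)
      fun p _ => hbdry p
    rwa [nsmul_eq_mul] at this
  -- the class deficit
  have hdef' : ∑ m, 2 * (r m - lev m) ≤ -(2 * N₀ * δ) := by
    have h1 : ∑ m, 2 * (r m - lev m) = 2 * (∑ m, r m) - 2 * ∑ m, lev m := by
      rw [← Finset.mul_sum, Finset.sum_sub_distrib]
      ring
    rw [h1]
    have h2 : ∑ m, r m ≤ (∑ m, lev m) - N₀ * δ := by simp only [hr, hlev]; exact hdef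
    linarith only [h2]
  -- interior count bounds
  have hcardI : ((n : ℝ) - 2 * k₀) ^ 3 ≤ (interiorSet k₀ n).card := by
    have h := card_interior_ge (k₀ := k₀) (n := n) (by omega)
    have h' : (((n - 2 * k₀) ^ 3 : ℕ) : ℝ) ≤ (interiorSet k₀ n).card := by exact_mod_cast h
    have hsub : ((n - 2 * k₀ : ℕ) : ℝ) = (n : ℝ) - 2 * k₀ := by
      rw [Nat.cast_sub (by omega)]
      push_cast
      ring
    rw [Nat.cast_pow, hsub] at h'
    exact h'
  have harith := block_arith hδ hβ0 hn4 hn1 hbig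
  have hN₀' : (1 : ℝ) ≤ N₀ := by exact_mod_cast hN₀
  -- `#I · T ≤ u³ · T` for the non-positive class deficit `T`
  have hT0 : ∑ m, 2 * (r m - lev m) ≤ 0 := by
    have : (0 : ℝ) ≤ 2 * N₀ * δ := by positivity
    linarith only [hdef', this]
  have hIle : ((interiorSet k₀ n).card : ℝ) * ∑ m, 2 * (r m - lev m) ≤ ((n : ℝ) - 2 * k₀) ^ 3 * (-(2 * N₀ * δ)) := by
    have h1 : ((interiorSet k₀ n).card : ℝ) * ∑ m, 2 * (r m - lev m) ≤ ((n : ℝ) - 2 * k₀) ^ 3 * ∑ m, 2 * (r m - lev m) :=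
      mul_le_mul_of_nonpos_right hcardI hT0
    have h2 : ((n : ℝ) - 2 * k₀) ^ 3 * ∑ m, 2 * (r m - lev m) ≤ ((n : ℝ) - 2 * k₀) ^ 3 * (-(2 * N₀ * δ)) := by
      have hu : (0 : ℝ) ≤ ((n : ℝ) - 2 * k₀) ^ 3 := by
        have : (0 : ℝ) ≤ (n : ℝ) - 2 * k₀ := by
          have : 4 * (k₀ : ℝ) ≤ n := by exact_mod_cast hn4
          linarith
        positivity
      exact mul_le_mul_of_nonneg_left hdef' hu
    exact h1.trans h2
  have hBle : (N₀ : ℝ) * ((n : ℝ) ^ 3 - (interiorSet k₀ n).card) * (2 * β) ≤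
      N₀ * ((n : ℝ) ^ 3 - ((n : ℝ) - 2 * k₀) ^ 3) * (2 * β) := by
    have h1 : (n : ℝ) ^ 3 - (interiorSet k₀ n).card ≤ (n : ℝ) ^ 3 - ((n : ℝ) - 2 * k₀) ^ 3 := by linarith only [hcardI]
    have hN₀0 : (0 : ℝ) ≤ N₀ := by linarith only [hN₀']
    have h2β : (0 : ℝ) ≤ 2 * β := by linarith only [hβ0]
    have := mul_le_mul_of_nonneg_left h1 hN₀0
    exact mul_le_mul_of_nonneg_right this h2β
  -- `2 N₀ (β (n³ − u³) − δ u³) < 0`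
  have hneg : ((n : ℝ) - 2 * k₀) ^ 3 * (-(2 * N₀ * δ)) + N₀ * ((n : ℝ) ^ 3 - ((n : ℝ) - 2 * k₀) ^ 3) * (2 * β) < 0 := by
    have : ((n : ℝ) - 2 * k₀) ^ 3 * (-(2 * N₀ * δ)) + N₀ * ((n : ℝ) ^ 3 - ((n : ℝ) - 2 * k₀) ^ 3) * (2 * β) =
        2 * N₀ * (β * ((n : ℝ) ^ 3 - ((n : ℝ) - 2 * k₀) ^ 3) - δ * ((n : ℝ) - 2 * k₀) ^ 3) := by ring
    rw [this]
    have h2N : (0 : ℝ) < 2 * N₀ := by linarith only [hN₀']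
    have hin : β * ((n : ℝ) ^ 3 - ((n : ℝ) - 2 * k₀) ^ 3) - δ * ((n : ℝ) - 2 * k₀) ^ 3 < 0 := by linarith only [harith]
    exact mul_neg_of_pos_of_neg h2N hin
  rw [hsplit, hI] at hsumX
  linarith only [hsumX, hB, hIle, hBle, hneg]

/-! ## §3. The Schur-cut X-residuals on flagged cells -/

/-- **Eopt♭-shape dies on a flagged cell for given `C_E, D_E, D_X`**: levels `(eUp − D_E) − (κ_E + C_E)·i₀ m + (κ_E + D_E)·i₁ m − D_X·iX m`. [folklore] -/
theorem not_schurElasticPricingX_of_cell_flags {N₀ M k₀ : ℕ} {x : Fin N₀ → E3} {a b : Fin 3 → E3} {cB ϱ diam : ℝ} (hN₀ : 1 ≤ N₀)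
    (hsep : PerSep x a) (hdual : ∀ j k, inner ℝ (b j) (a k) = if j = k then (1 : ℝ) else 0) (hb : ∀ j, ‖b j‖ ≤ cB)
    (hdiam : DiamLE x diam) (hk₀ : cB * (ϱ + diam) < k₀ + 1)
    {μ : Fin M → Fin N₀} {σ : Fin M → Fin 3 → ℤ} (hμσ : Function.Injective fun q => (μ q, σ q)) (hσ : ∀ q k, |σ q k| ≤ k₀)
    (hsup : ∀ (m : Fin N₀) (s : Fin 3 → ℤ), (∀ k, |s k| ≤ k₀) → ∃ q, μ q = m ∧ σ q = s)
    {cidx : Fin N₀ → Fin M} (hc : ∀ m, μ (cidx m) = m ∧ σ (cidx m) = 0)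
    {w ω : ℝ → ℝ} {A R Wsup : ℝ} (hR0 : 0 ≤ R) (hW : ∀ r, R ≤ r → effPot w ω A r = 0) (hRϱ : R ≤ ϱ)
    (hWle : ∀ r, (7 : ℝ) / 10 ≤ r → effPot w ω A r ≤ Wsup) (hWsup : 0 ≤ Wsup)
    {η₀ η₁ D : ℝ} (hD : 13 / 10 * D + 1 ≤ ϱ) (hη₀ : η₀ ≤ 3 / 10) (hη₁ : η₁ ≤ 3 / 10) {i₀ i₁ : Fin N₀ → ℝ}
    (hfl₀ : ∀ m, (i₀ m = 1 ∧ GoodAtScale η₀ D (superMotif x a μ σ) (cidx m)) ∨ (i₀ m = 0 ∧ ¬ MaybeGoodAt η₀ D (superMotif x a μ σ) (cidx m)))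
    (hfl₁ : ∀ m, (i₁ m = 1 ∧ GoodAtScale η₁ D (superMotif x a μ σ) (cidx m)) ∨ (i₁ m = 0 ∧ ¬ MaybeGoodAt η₁ D (superMotif x a μ σ) (cidx m)))
    (Ex : SitePred) {iX : Fin N₀ → ℝ}
    (hflX : ∀ (n N : ℕ) (e : (Fin N₀ × (Fin 3 → Fin n)) ≃ Fin N) (m : Fin N₀) (t : Fin 3 → Fin n), Interior k₀ n t →
      (iX m = 1 ∧ Ex N (block x a n ∘ e.symm) (e (m, t))) ∨ (iX m = 0 ∧ ¬ Ex N (block x a n ∘ e.symm) (e (m, t))))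
    {eUp κE CE DE DX δ : ℝ} (hδ : 0 < δ)
    (hdef : ∑ m, (((∑ q, effPot w ω A (dist (x m) (superMotif x a μ σ q))) - effPot w ω A 0) / 2 - A) ≤
      (∑ m, ((eUp - DE) + (-(κE + CE)) * i₀ m + (κE + DE) * i₁ m + (-DX) * iX m)) - N₀ * δ) :
    ¬ SchurElasticPricingX η₀ η₁ w ω A eUp κE CE DE DX Ex := fun h =>
  not_pairLevelLawX_of_cell_flags hN₀ hsep hdual hb hdiam hk₀ hμσ hσ hsup hc hR0 hW hRϱ hWle hWsup hD hη₀ hη₁ hfl₀ hfl₁ Ex hflX hδ hdef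
    fun N y hy hs => by have := h N y hy hs; linarith

/-- **Topt♭-shape dies on a flagged cell for given `C_T, D_T`**: levels `(eUp + κ_T) − C_T·i₀ m − κ_T·i₁ m − D_T·iX m`. [folklore] -/
theorem not_schurTopologicalPricingX_of_cell_flags {N₀ M k₀ : ℕ} {x : Fin N₀ → E3} {a b : Fin 3 → E3} {cB ϱ diam : ℝ} (hN₀ : 1 ≤ N₀)
    (hsep : PerSep x a) (hdual : ∀ j k, inner ℝ (b j) (a k) = if j = k then (1 : ℝ) else 0) (hb : ∀ j, ‖b j‖ ≤ cB)
    (hdiam : DiamLE x diam) (hk₀ : cB * (ϱ + diam) < k₀ + 1)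
    {μ : Fin M → Fin N₀} {σ : Fin M → Fin 3 → ℤ} (hμσ : Function.Injective fun q => (μ q, σ q)) (hσ : ∀ q k, |σ q k| ≤ k₀)
    (hsup : ∀ (m : Fin N₀) (s : Fin 3 → ℤ), (∀ k, |s k| ≤ k₀) → ∃ q, μ q = m ∧ σ q = s)
    {cidx : Fin N₀ → Fin M} (hc : ∀ m, μ (cidx m) = m ∧ σ (cidx m) = 0)
    {w ω : ℝ → ℝ} {A R Wsup : ℝ} (hR0 : 0 ≤ R) (hW : ∀ r, R ≤ r → effPot w ω A r = 0) (hRϱ : R ≤ ϱ)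
    (hWle : ∀ r, (7 : ℝ) / 10 ≤ r → effPot w ω A r ≤ Wsup) (hWsup : 0 ≤ Wsup)
    {η₀ η₁ D : ℝ} (hD : 13 / 10 * D + 1 ≤ ϱ) (hη₀ : η₀ ≤ 3 / 10) (hη₁ : η₁ ≤ 3 / 10) {i₀ i₁ : Fin N₀ → ℝ}
    (hfl₀ : ∀ m, (i₀ m = 1 ∧ GoodAtScale η₀ D (superMotif x a μ σ) (cidx m)) ∨ (i₀ m = 0 ∧ ¬ MaybeGoodAt η₀ D (superMotif x a μ σ) (cidx m)))
    (hfl₁ : ∀ m, (i₁ m = 1 ∧ GoodAtScale η₁ D (superMotif x a μ σ) (cidx m)) ∨ (i₁ m = 0 ∧ ¬ MaybeGoodAt η₁ D (superMotif x a μ σ) (cidx m)))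
    (Ex : SitePred) {iX : Fin N₀ → ℝ}
    (hflX : ∀ (n N : ℕ) (e : (Fin N₀ × (Fin 3 → Fin n)) ≃ Fin N) (m : Fin N₀) (t : Fin 3 → Fin n), Interior k₀ n t →
      (iX m = 1 ∧ Ex N (block x a n ∘ e.symm) (e (m, t))) ∨ (iX m = 0 ∧ ¬ Ex N (block x a n ∘ e.symm) (e (m, t))))
    {eUp κT CT DT δ : ℝ} (hδ : 0 < δ)
    (hdef : ∑ m, (((∑ q, effPot w ω A (dist (x m) (superMotif x a μ σ q))) - effPot w ω A 0) / 2 - A) ≤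
      (∑ m, ((eUp + κT) + (-CT) * i₀ m + (-κT) * i₁ m + (-DT) * iX m)) - N₀ * δ) :
    ¬ SchurTopologicalPricingX η₀ η₁ w ω A eUp κT CT DT Ex := fun h =>
  not_pairLevelLawX_of_cell_flags hN₀ hsep hdual hb hdiam hk₀ hμσ hσ hsup hc hR0 hW hRϱ hWle hWsup hD hη₀ hη₁ hfl₀ hfl₁ Ex hflX hδ hdef
    fun N y hy hs => by have := h N y hy hs; linarith

/-- The NON-EXEMPT flag pattern `iX = 0` from a uniform interior non-exemption certificate. [folklore] -/
theorem flagsX_of_nonExempt {N₀ k₀ : ℕ} {x : Fin N₀ → E3} {a : Fin 3 → E3} {Ex : SitePred}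
    (hnex : ∀ (n N : ℕ) (e : (Fin N₀ × (Fin 3 → Fin n)) ≃ Fin N) (m : Fin N₀) (t : Fin 3 → Fin n), Interior k₀ n t →
      ¬ Ex N (block x a n ∘ e.symm) (e (m, t))) :
    ∀ (n N : ℕ) (e : (Fin N₀ × (Fin 3 → Fin n)) ≃ Fin N) (m : Fin N₀) (t : Fin 3 → Fin n), Interior k₀ n t →
      ((fun _ : Fin N₀ => (0 : ℝ)) m = 1 ∧ Ex N (block x a n ∘ e.symm) (e (m, t))) ∨
        ((fun _ : Fin N₀ => (0 : ℝ)) m = 0 ∧ ¬ Ex N (block x a n ∘ e.symm) (e (m, t))) :=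
  fun n N e m t ht => Or.inr ⟨rfl, hnex n N e m t ht⟩

/-- ★ **Eopt♭-shape DIES FOR EVERY `C_E, D_E, D_X` on an all-STRAINED NON-EXEMPT cell**: every class `(η₁, D)`-capped-good and not `(η₀, D)`-maybe-good,
every interior block site non-exempt, deficit below `eUp + κ_E`. [folklore] -/
theorem not_schurElasticPricingX_of_cell_strained_nonExempt {N₀ M k₀ : ℕ} {x : Fin N₀ → E3} {a b : Fin 3 → E3} {cB ϱ diam : ℝ} (hN₀ : 1 ≤ N₀)
    (hsep : PerSep x a) (hdual : ∀ j k, inner ℝ (b j) (a k) = if j = k then (1 : ℝ) else 0) (hb : ∀ j, ‖b j‖ ≤ cB)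
    (hdiam : DiamLE x diam) (hk₀ : cB * (ϱ + diam) < k₀ + 1)
    {μ : Fin M → Fin N₀} {σ : Fin M → Fin 3 → ℤ} (hμσ : Function.Injective fun q => (μ q, σ q)) (hσ : ∀ q k, |σ q k| ≤ k₀)
    (hsup : ∀ (m : Fin N₀) (s : Fin 3 → ℤ), (∀ k, |s k| ≤ k₀) → ∃ q, μ q = m ∧ σ q = s)
    {cidx : Fin N₀ → Fin M} (hc : ∀ m, μ (cidx m) = m ∧ σ (cidx m) = 0)
    {w ω : ℝ → ℝ} {A R Wsup : ℝ} (hR0 : 0 ≤ R) (hW : ∀ r, R ≤ r → effPot w ω A r = 0) (hRϱ : R ≤ ϱ)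
    (hWle : ∀ r, (7 : ℝ) / 10 ≤ r → effPot w ω A r ≤ Wsup) (hWsup : 0 ≤ Wsup)
    {η₀ η₁ D : ℝ} (hD : 13 / 10 * D + 1 ≤ ϱ) (hη₀ : η₀ ≤ 3 / 10) (hη₁ : η₁ ≤ 3 / 10)
    (hgood : ∀ m, GoodAtScale η₁ D (superMotif x a μ σ) (cidx m)) (hbad : ∀ m, ¬ MaybeGoodAt η₀ D (superMotif x a μ σ) (cidx m))
    (Ex : SitePred)
    (hnex : ∀ (n N : ℕ) (e : (Fin N₀ × (Fin 3 → Fin n)) ≃ Fin N) (m : Fin N₀) (t : Fin 3 → Fin n), Interior k₀ n t →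
      ¬ Ex N (block x a n ∘ e.symm) (e (m, t)))
    {eUp κE δ : ℝ} (hδ : 0 < δ)
    (hdef : ∑ m, (((∑ q, effPot w ω A (dist (x m) (superMotif x a μ σ q))) - effPot w ω A 0) / 2 - A) ≤ N₀ * (eUp + κE - δ))
    (CE DE DX : ℝ) : ¬ SchurElasticPricingX η₀ η₁ w ω A eUp κE CE DE DX Ex :=
  not_schurElasticPricingX_of_cell_flags hN₀ hsep hdual hb hdiam hk₀ hμσ hσ hsup hc hR0 hW hRϱ hWle hWsup hD hη₀ hη₁ (flags_of_allBad hbad)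
    (flags_of_good hgood) Ex (flagsX_of_nonExempt hnex) hδ (hdef.trans (le_of_eq (by simp; ring)))

/-- ★ **Topt♭-shape DIES FOR EVERY `C_T, D_T` on an ALL-BAD NON-EXEMPT cell**: every class not `(η₁, D)`-maybe-good (`η₀ ≤ η₁ ≤ 3/10`), every
interior block site non-exempt, deficit below `eUp + κ_T`. [folklore] -/
theorem not_schurTopologicalPricingX_of_cell_allBad_nonExempt {N₀ M k₀ : ℕ} {x : Fin N₀ → E3} {a b : Fin 3 → E3} {cB ϱ diam : ℝ}
    (hN₀ : 1 ≤ N₀) (hsep : PerSep x a) (hdual : ∀ j k, inner ℝ (b j) (a k) = if j = k then (1 : ℝ) else 0) (hb : ∀ j, ‖b j‖ ≤ cB)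
    (hdiam : DiamLE x diam) (hk₀ : cB * (ϱ + diam) < k₀ + 1)
    {μ : Fin M → Fin N₀} {σ : Fin M → Fin 3 → ℤ} (hμσ : Function.Injective fun q => (μ q, σ q)) (hσ : ∀ q k, |σ q k| ≤ k₀)
    (hsup : ∀ (m : Fin N₀) (s : Fin 3 → ℤ), (∀ k, |s k| ≤ k₀) → ∃ q, μ q = m ∧ σ q = s)
    {cidx : Fin N₀ → Fin M} (hc : ∀ m, μ (cidx m) = m ∧ σ (cidx m) = 0)
    {w ω : ℝ → ℝ} {A R Wsup : ℝ} (hR0 : 0 ≤ R) (hW : ∀ r, R ≤ r → effPot w ω A r = 0) (hRϱ : R ≤ ϱ)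
    (hWle : ∀ r, (7 : ℝ) / 10 ≤ r → effPot w ω A r ≤ Wsup) (hWsup : 0 ≤ Wsup)
    {η₀ η₁ D : ℝ} (hD : 13 / 10 * D + 1 ≤ ϱ) (hη₀₁ : η₀ ≤ η₁) (hη₁ : η₁ ≤ 3 / 10)
    (hbad : ∀ m, ¬ MaybeGoodAt η₁ D (superMotif x a μ σ) (cidx m)) (Ex : SitePred)
    (hnex : ∀ (n N : ℕ) (e : (Fin N₀ × (Fin 3 → Fin n)) ≃ Fin N) (m : Fin N₀) (t : Fin 3 → Fin n), Interior k₀ n t →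
      ¬ Ex N (block x a n ∘ e.symm) (e (m, t)))
    {eUp κT δ : ℝ} (hδ : 0 < δ)
    (hdef : ∑ m, (((∑ q, effPot w ω A (dist (x m) (superMotif x a μ σ q))) - effPot w ω A 0) / 2 - A) ≤ N₀ * (eUp + κT - δ))
    (CT DT : ℝ) : ¬ SchurTopologicalPricingX η₀ η₁ w ω A eUp κT CT DT Ex :=
  not_schurTopologicalPricingX_of_cell_flags hN₀ hsep hdual hb hdiam hk₀ hμσ hσ hsup hc hR0 hW hRϱ hWle hWsup hD (hη₀₁.trans hη₁) hη₁
    (flags_of_allBad fun m => not_maybeGoodAt_anti hη₀₁ (hbad m)) (flags_of_allBad hbad) Ex (flagsX_of_nonExempt hnex) hδ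
    (hdef.trans (le_of_eq (by simp; ring)))

end Summit.AtomisticToContinuum.Crystallization.Theorems.FrustratedLawDichotomyPeriodicBlockFlagsX

end
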